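import Literature.Probability.LatticeModels.AizenmanHiguchiAssembly
import Literature.Probability.LatticeModels.BadPercolationEnclosure
import Literature.Probability.Percolation.LatticeSymmetry
import HarnessLib

/-!
# Aizenman–Higuchi from good crossings above a square for the horizontally duplicated system
# (Georgii–Higuchi 2000, Lemma 5.5 "claim" ⇒ Lemma 5.5 ⇒ Prop. 5.1 ⇒ Theorem)

Topic `Probability/LatticeModels`; theorems only. Georgii–Higuchi, J. Math. Phys. 41 (2000), proof
of Lemma 5.5 (p. 15): "We claim that with `ν̂`-probability at least `(θ/4)²` there exists a `≤∗`path
from `x` to `y` 'above' `Δ`, provided `x` and `y` are located sufficiently far to the left resp. to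
the right" — for an extremal `μ`, its horizontal translate `μ̂ = μ ∘ θ_h⁻¹` and `ν̂ = μ ⊗ μ̂`. This file
shows that this **claim**, for every tail-trivial `μ ∈ 𝒢(β, 0)` on `ℤ²` and both horizontal unit
translates, is all that remains of the Aizenman–Higuchi theorem (`aizenman_higuchi`,
`GibbsStates.lean`), by wiring the tree's pieces exactly along the printed text:

* "its analogue for the lower half-plane" — the claim for the reflected measure `μ ∘ R⁻¹`
  (`measure_lowerGoodCrossing_shift_eq`, `BadPercolationEnclosure`);
* "`ν̂(A_{x,y} ∩ B_{x,y}) ≥ ν̂(A_{x,y}) ν̂(B_{x,y})` … `Δ` is surrounded by a `≤∗`circuit"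
  (`measure_goodCrossings_mul_le`);
* "measurable with respect to the product-tail `𝒯⁽²⁾` on which `ν̂` is trivial" and Prop. 5.1
  "as in Aizenman" (`ae_no_badPercolation_of_enclosure`, `AizenmanHiguchiAssembly`);
* "The vertical invariance follows similarly by an interchange of coordinates"
  (`ae_no_badPercolation_vertical_of_transpose`: the vertically duplicated system of `μ` is the
  horizontally duplicated system of the transposed measure `μ ∘ τ⁻¹`, transported along `τ × τ`);
* **`aizenman_higuchi_of_upperGoodCrossing_bound`** — the final reduction.

## References

* H.-O. Georgii, Y. Higuchi, J. Math. Phys. 41 (2000) 1153–1169, Lemma 5.5 and Prop. 5.1 with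
  their proofs (pp. 15–16 of arXiv:math/9907186) [GeorgiiHiguchi2000].
-/

noncomputable section

open MeasureTheory ProbabilityTheory Filter Topology SimpleGraph
open Literature.Probability.Percolation
open scoped ENNReal

namespace Literature.Probability.LatticeModels

/-! ### Transport of "no bad percolation" along lattice automorphisms -/

section Transport

/-- Bad sites are covariant under lattice automorphisms acting on both layers. [folklore] -/
theorem spinSites_badConfig_prodMap_configRelabel (φ : zdGraph 2 ≃g zdGraph 2)
    (p : SpinConfig (Site 2) × SpinConfig (Site 2)) :
    spinSites 1 (badConfig (Prod.map (configRelabel φ.toEquiv) (configRelabel φ.toEquiv) p)) =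
      φ '' spinSites 1 (badConfig p) := by
  have hcfg : badConfig (Prod.map (configRelabel φ.toEquiv) (configRelabel φ.toEquiv) p) =
      configRelabel φ.toEquiv (badConfig p) := by
    funext z
    by_cases hc : p.1 (φ.toEquiv.symm z) = 1 ∧ p.2 (φ.toEquiv.symm z) = -1 <;>
      simp [badConfig, configRelabel_apply, hc]
  rw [hcfg, spinSites_configRelabel]
  rfl

/-- "No bad cluster is infinite" is invariant under lattice automorphisms acting on both layers. [folklore] -/
theorem forall_not_infinite_badCluster_prodMap_configRelabel_iff (φ : zdGraph 2 ≃g zdGraph 2)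
    (p : SpinConfig (Site 2) × SpinConfig (Site 2)) :
    (∀ t, ¬ (siteCluster (zdGraph 2) (spinSites 1 (badConfig
        (Prod.map (configRelabel φ.toEquiv) (configRelabel φ.toEquiv) p))) t).Infinite) ↔
      ∀ t, ¬ (siteCluster (zdGraph 2) (spinSites 1 (badConfig p)) t).Infinite := by
  rw [spinSites_badConfig_prodMap_configRelabel]
  have key : ∀ y, siteCluster (zdGraph 2) (φ '' spinSites 1 (badConfig p)) (φ y) =
      φ '' siteCluster (zdGraph 2) (spinSites 1 (badConfig p)) y := fun y => by
    have h := siteCluster_relabel φ (spinSites 1 (badConfig p)) y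
    rwa [SiteConfig.relabel_apply] at h
  constructor
  · intro h y hy
    refine h (φ y) ?_
    rw [key]
    exact hy.image φ.injective.injOn
  · intro h t ht
    refine h (φ.symm t) ?_
    have hk := key (φ.symm t)
    rw [RelIso.apply_symm_apply] at hk
    rw [hk] at ht
    exact Set.Infinite.of_image _ ht

/-- Almost-sure absence of bad percolation is transported along `φ × φ`. [folklore] -/
theorem ae_no_badPercolation_map_prodMap_iff (φ : zdGraph 2 ≃g zdGraph 2)
    (ν : Measure (SpinConfig (Site 2) × SpinConfig (Site 2))) :
    (∀ᵐ p ∂(ν.map (Prod.map (configRelabel φ.toEquiv) (configRelabel φ.toEquiv))),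
        ∀ t, ¬ (siteCluster (zdGraph 2) (spinSites 1 (badConfig p)) t).Infinite) ↔
      ∀ᵐ p ∂ν, ∀ t, ¬ (siteCluster (zdGraph 2) (spinSites 1 (badConfig p)) t).Infinite := by
  have hφ : Measurable (configRelabel φ.toEquiv : SpinConfig (Site 2) → SpinConfig (Site 2)) :=
    (configRelabel _).measurable
  have hset : MeasurableSet {p : SpinConfig (Site 2) × SpinConfig (Site 2) |
      ∀ t, ¬ (siteCluster (zdGraph 2) (spinSites 1 (badConfig p)) t).Infinite} := by
    have : {p : SpinConfig (Site 2) × SpinConfig (Site 2) |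
        ∀ t, ¬ (siteCluster (zdGraph 2) (spinSites 1 (badConfig p)) t).Infinite} =
        {p : SpinConfig (Site 2) × SpinConfig (Site 2) |
          ∃ x, (siteCluster (zdGraph 2) (spinSites 1 (badConfig p)) x).Infinite}ᶜ := by
      ext p; exact not_mem_badPercolation_iff.symm
    rw [this]
    exact measurableSet_badPercolation.compl
  rw [ae_map_iff (hφ.prodMap hφ).aemeasurable hset]
  simp only [forall_not_infinite_badCluster_prodMap_configRelabel_iff]

end Transport

/-! ### Interchange of coordinates -/

section Transpose

/-- The transposition is additive. [folklore] -/
theorem transposeIso_sub (x y : Site 2) : (transposeIso (x - y) : Site 2) = transposeIso x - transposeIso y := by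
  rw [transposeIso_apply, transposeIso_apply, transposeIso_apply]
  ext i; fin_cases i <;> simp

/-- The transposition is an involution. [folklore] -/
theorem transposeIso_transposeIso (x : Site 2) : (transposeIso (transposeIso x) : Site 2) = x := by
  rw [← transposeIso_symm_apply]; exact transposeIso.symm_apply_apply x

/-- **Translations conjugate under the transposition**: `τ ∘ θ_v = θ_{τ v} ∘ τ` on configurations. [folklore] -/
theorem configRelabel_transpose_comp_configShift (v : Site 2) :
    (configRelabel transposeIso.toEquiv : SpinConfig (Site 2) → SpinConfig (Site 2)) ∘ configShift v =
      configShift (transposeIso v) ∘ configRelabel transposeIso.toEquiv := by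
  funext σ; funext y
  simp only [Function.comp_apply, configRelabel_apply, configShift_apply]
  rw [show transposeIso.toEquiv.symm y = transposeIso.symm y from rfl,
    show transposeIso.toEquiv.symm (y - transposeIso v) = transposeIso.symm (y - transposeIso v) from rfl,
    transposeIso_symm_apply, transposeIso_symm_apply, transposeIso_sub, transposeIso_transposeIso]

/-- The transpose of the vertical unit vector is the horizontal one. [folklore] -/
theorem transposeIso_single_one (s : ℤ) : (transposeIso (Pi.single 1 s : Site 2) : Site 2) = Pi.single 0 s := by
  rw [transposeIso_apply]
  ext i; fin_cases i <;> simp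

/-- **"The vertical invariance follows similarly by an interchange of coordinates"** (Georgii–Higuchi
2000, end of the proof of Prop. 5.1): the vertically duplicated system `μ ⊗ (μ ∘ θ_{s e₂}⁻¹)` is the
image under `τ × τ` of the horizontally duplicated system of the transposed measure `μ_τ = μ ∘ τ⁻¹`,
so the almost-sure absence of bad percolation passes from the latter to the former. [cite: GeorgiiHiguchi2000, Prop. 5.1 (proof, p. 16)] -/
theorem ae_no_badPercolation_vertical_of_transpose (μ : Measure (SpinConfig (Site 2))) [SFinite μ] (s : ℤ)
    (h : ∀ᵐ p ∂((μ.map (configRelabel transposeIso.toEquiv)).prod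
        ((μ.map (configRelabel transposeIso.toEquiv)).map (configShift (Pi.single 0 s)))),
      ∀ t, ¬ (siteCluster (zdGraph 2) (spinSites 1 (badConfig p)) t).Infinite) :
    ∀ᵐ p ∂(μ.prod (μ.map (configShift (Pi.single 1 s)))),
      ∀ t, ¬ (siteCluster (zdGraph 2) (spinSites 1 (badConfig p)) t).Infinite := by
  have hτ : Measurable (configRelabel transposeIso.toEquiv : SpinConfig (Site 2) → SpinConfig (Site 2)) :=
    (configRelabel _).measurable
  have hprod : (μ.map (configRelabel transposeIso.toEquiv)).prod
      ((μ.map (configRelabel transposeIso.toEquiv)).map (configShift (Pi.single 0 s))) =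
      (μ.prod (μ.map (configShift (Pi.single 1 s)))).map
        (Prod.map (configRelabel transposeIso.toEquiv) (configRelabel transposeIso.toEquiv)) := by
    rw [← Measure.map_prod_map _ _ hτ hτ, Measure.map_map hτ (configShift _).measurable,
      Measure.map_map (configShift _).measurable hτ, configRelabel_transpose_comp_configShift,
      transposeIso_single_one]
  rw [hprod, ae_no_badPercolation_map_prodMap_iff] at h
  exact h

end Transpose

/-! ### The theorem from the claim -/

section Main

variable {β : ℝ}

/-- **Lemma 5.5 (almost-sure form) for the horizontally duplicated system, from the claim**
(Georgii–Higuchi 2000, proof of Lemma 5.5, last paragraph): if for every tail-trivial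
`μ ∈ 𝒢(β, 0)`, `β > β_c(2)`, and each horizontal unit vector `v = s e₁` there is `c > 0` such that for
every `n`, for all `x = (-a, 0)`, `y = (b, 0)` far enough out, with `μ ⊗ (μ ∘ θ_v⁻¹)`-probability at
least `c` some `∗`-walk of good sites joins `x` to `y` avoiding the lower band of `Λ_n`, then for every
such `μ` and `v`, `μ ⊗ (μ ∘ θ_v⁻¹)`-almost surely no lattice cluster of bad sites is infinite
("the claim and its analogue for the lower half-plane", positive correlations, enclosure, product-tail
triviality). [cite: GeorgiiHiguchi2000, Lemma 5.5 (proof, pp. 15–16)] -/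
theorem ae_no_badPercolation_horizontal_of_upperGoodCrossing_bound (hβc : criticalBeta 2 < β)
    (h : ∀ μ ∈ isingGibbsMeasures 2 β 0, IsTailTrivial μ → ∀ s : ℤˣ,
      ∃ c : ℝ≥0∞, 0 < c ∧ ∀ n : ℕ, ∃ a₀ b₀ : ℕ, ∀ a b : ℕ, a₀ ≤ a → b₀ ≤ b →
        c ≤ (μ.prod (μ.map (configShift (Pi.single 0 (s : ℤ)))))
          {p | ∃ α : zdStarGraph.Walk (![-(a : ℤ), 0]) (![(b : ℤ), 0]),
            ∀ z ∈ α.support, p.1 z ≤ p.2 z ∧ ¬ (-(n : ℤ) ≤ z 0 ∧ z 0 ≤ n ∧ z 1 ≤ n)})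
    {μ : Measure (SpinConfig (Site 2))} (hμ : μ ∈ isingGibbsMeasures 2 β 0) (hμt : IsTailTrivial μ) (s : ℤˣ) :
    ∀ᵐ p ∂(μ.prod (μ.map (configShift (Pi.single 0 (s : ℤ))))),
      ∀ t, ¬ (siteCluster (zdGraph 2) (spinSites 1 (badConfig p)) t).Infinite := by
  have hβ : 0 ≤ β := (criticalBeta_nonneg 2).trans hβc.le
  have hμG : IsGibbsMeasure (isingSpecification (zdGraph 2) β 0) μ := hμ
  haveI := hμG.isProbabilityMeasure
  set v : Site 2 := Pi.single 0 (s : ℤ) with hv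
  -- the translate
  have hμv : μ.map (configShift v) ∈ isingGibbsMeasures 2 β 0 := mem_isingGibbsMeasures_map_configShift hμ v
  have hμvt : IsTailTrivial (μ.map (configShift (S := ℤˣ) v)) := hμt.map_configRelabel (Site.shift v)
  haveI : IsProbabilityMeasure (μ.map (configShift (S := ℤˣ) v)) :=
    Measure.isProbabilityMeasure_map (configShift v).measurable.aemeasurable
  -- the reflected measure
  have hμR : μ.map (configRelabel (reflectCoord (d := 2) 1).toEquiv) ∈ isingGibbsMeasures 2 β 0 :=
    IsGibbsMeasure.map_configRelabel _ (reflectCoord 1) hμG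
  have hμRt : IsTailTrivial (μ.map (configRelabel (reflectCoord (d := 2) 1).toEquiv)) := hμt.map_configRelabel _
  obtain ⟨t, ht⟩ := reflectCoord_one_single 0 s
  -- the two constants
  obtain ⟨c, hc, hcn⟩ := h μ hμ hμt s
  obtain ⟨c', hc', hcn'⟩ := h _ hμR hμRt t
  refine ae_no_badPercolation_of_enclosure hμt hμvt (c := c * c') (ENNReal.mul_pos hc.ne' hc'.ne') fun n => ?_
  obtain ⟨a₀, b₀, hab⟩ := hcn n
  obtain ⟨a₀', b₀', hab'⟩ := hcn' n
  set a : ℕ := max (max a₀ a₀') (n + 1) with ha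
  set b : ℕ := max (max b₀ b₀') (n + 1) with hb
  have hna : n < a := by omega
  have hnb : n < b := by omega
  have hU := hab a b (by omega) (by omega)
  have hL : c' ≤ (μ.prod (μ.map (configShift v)))
      {p : SpinConfig (Site 2) × SpinConfig (Site 2) | ∃ α : zdStarGraph.Walk (![-(a : ℤ), 0]) (![(b : ℤ), 0]),
        ∀ z ∈ α.support, p.1 z ≤ p.2 z ∧ ¬ (-(n : ℤ) ≤ z 0 ∧ z 0 ≤ n ∧ -(n : ℤ) ≤ z 1)} := by
    rw [measure_lowerGoodCrossing_shift_eq μ v n (-(a : ℤ)) (b : ℤ), hv, ht]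
    exact hab' a b (by omega) (by omega)
  calc c * c' ≤ _ * _ := mul_le_mul' hU hL
    _ ≤ _ := measure_goodCrossings_mul_le hβ hβ hμ hμt hμv hμvt hna hnb

/-- **The Aizenman–Higuchi theorem from the claim of Georgii–Higuchi's Lemma 5.5.** Suppose that for
`β > β_c(2)`, every tail-trivial `μ ∈ 𝒢(β, 0)` on `ℤ²` and each horizontal unit vector `v = s e₁`
(`s = ±1`) there is `c > 0` such that for every square `Λ_n`, for all `x = (-a, 0)` and `y = (b, 0)`
sufficiently far out, with `μ ⊗ (μ ∘ θ_v⁻¹)`-probability at least `c` there is a `∗`-walk from `x`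
to `y` all of whose sites `z` are good (`ω z ≤ ω̂ z`) and avoid the lower band
`{|z₁| ≤ n, z₂ ≤ n}` ("a `≤∗`path from `x` to `y` above `Δ`"; Georgii–Higuchi prove this with
`c = (θ/4)²`, Cases 1–3 of the proof of Lemma 5.5). Then the named fact `aizenman_higuchi` holds at
`β`: Lemma 5.5 for the horizontal translates (`ae_no_badPercolation_horizontal_of_upperGoodCrossing_bound`),
for the vertical translates by interchange of coordinates
(`ae_no_badPercolation_vertical_of_transpose`), Prop. 5.1 and the theorem
(`aizenman_higuchi_of_ae_no_badPercolation`). [cite: GeorgiiHiguchi2000, Lemma 5.5, Prop. 5.1 and Thm. (p. 12)] -/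
theorem aizenman_higuchi_of_upperGoodCrossing_bound
    (h : criticalBeta 2 < β → ∀ μ ∈ isingGibbsMeasures 2 β 0, IsTailTrivial μ → ∀ s : ℤˣ,
      ∃ c : ℝ≥0∞, 0 < c ∧ ∀ n : ℕ, ∃ a₀ b₀ : ℕ, ∀ a b : ℕ, a₀ ≤ a → b₀ ≤ b →
        c ≤ (μ.prod (μ.map (configShift (Pi.single 0 (s : ℤ)))))
          {p | ∃ α : zdStarGraph.Walk (![-(a : ℤ), 0]) (![(b : ℤ), 0]),
            ∀ z ∈ α.support, p.1 z ≤ p.2 z ∧ ¬ (-(n : ℤ) ≤ z 0 ∧ z 0 ≤ n ∧ z 1 ≤ n)}) :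
    aizenman_higuchi (β := β) := by
  refine aizenman_higuchi_of_ae_no_badPercolation fun hβc μ hμ hμt i s => ?_
  have hμG : IsGibbsMeasure (isingSpecification (zdGraph 2) β 0) μ := hμ
  haveI := hμG.isProbabilityMeasure
  fin_cases i
  · exact ae_no_badPercolation_horizontal_of_upperGoodCrossing_bound hβc (h hβc) hμ hμt s
  · -- interchange of coordinates
    have hμT : μ.map (configRelabel transposeIso.toEquiv) ∈ isingGibbsMeasures 2 β 0 :=
      IsGibbsMeasure.map_configRelabel _ transposeIso hμG
    have hμTt : IsTailTrivial (μ.map (configRelabel transposeIso.toEquiv)) := hμt.map_configRelabel _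
    have hT := ae_no_badPercolation_horizontal_of_upperGoodCrossing_bound hβc (h hβc) hμT hμTt s
    exact ae_no_badPercolation_vertical_of_transpose μ (s : ℤ) hT

end Main

end Literature.Probability.LatticeModels
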